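import Mathlib
import Literature.Computability.Complexity.AlgebraicPCP
import Literature.Computability.Complexity.DigitPolynomials
import Literature.Computability.Complexity.BoolEncodings
import Literature.Computability.Complexity.BlockTuples
import HarnessLib

/-!
# Bit layout of algebraic PCP proofs and tapes over `ZMod p` (machine layer of the BFL/BFLS verifier, II)

Literature / complexity toolkit, second MACHINE-LAYER brick of the probabilistically checkable
proofs for exponential-time computations (after `FieldElementsFromCoins.lean`), over the algebraic
proof system of `AlgebraicPCP.lean` (Babai–Fortnow–Lund 1991, §4–§7 / Babai–Fortnow–Levin–Szegedy
1991, §5): a proof is an oracle `Y : Fᵐ → F` with a table `S` of sumcheck messages, the verifier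
draws a structured tape `τ` (`AlgebraicPCP.Tape`) and accepts iff `AlgebraicPCP.Accept H prm C π τ`.
The tree's `PCPVerifier` (`PCP.lean`) reads BITS of a proof STRING at computed positions and tosses
coins. This file is the dictionary between the two, for the prime field `F = ZMod p` (pure
definitions and reading lemmas; no machine is written here — the `FP` programmes computing these
positions and checks, the honest proof string in `FE`, and the assembly of a `PCPVerifier` are the
sequels):

* **blocks**: `word B v` (the `B`-bit little-endian word of `v`, `bitsToNat_word`), `readN`/`readF`
  (the number / field element held by the `B` bits of a bit oracle at a position);
* **proof layout** (`§ Layout`): the value `Y z` sits in the block at `B · ptIdx z`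
  (`ptIdx z = ∑ᵤ val zᵤ · pᵘ < pᵐ`, `DigitPoly.dval`), the coefficient `j ≤ D` of the message
  `S ρ seed pref` in the block at `offY + B((D+1) · msgKey ρ seed pref + j)`;
  **`decodeProof`** — EVERY bit oracle `ℕ → Bool` decodes to an `AlgebraicPCP.Proof (ZMod p) K m N`
  (so that soundness, quantified over abstract proofs, covers all proof strings), with
  `natDegree_decodeS_le` (decoded messages have degree `≤ D` by format);
* **tape layout** (`§ Tape`): `tapeOf` — the structured tape read off a tuple
  `t : Fin (tapeLen K m T Q) → F` (`ρ`, seed, challenges, `T` test pairs, `Q` directions, in this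
  order, the directions of the queries `C.Qry` through an enumeration `e : C.Qry ≃ Fin Q`), and
  **`tapeOf_bijective`** (so that a count of accepting tapes is a count of accepting tuples,
  `FieldElementsFromCoins.card_filter_comp_of_bijective`);
* **queries** (`§ Queries`): the list `queries … τ : List ℕ` of proof positions the verifier
  reads — the `B`-bit blocks of `Y` at the `T(d+2)` points of the low-degree tests and at the
  `Q(d+1)` points of the self-corrected reads, then the `K(D+1)` coefficient blocks of the messages
  along the challenge prefixes — and the reading lemmas `valAt_queries_*`: the `k`-th block of the
  answer list `(queries τ).map πb` is the corresponding value of `decodeProof πb`;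
* **the verdict** (`§ Verdict`): `verdict … τ ans : Bool`, the verifier's decision as a function of
  the tape and the answer bits (finite-difference test sums, Lagrange self-correction weights
  `scWeight` with `selfCorrect_eq_sum`, the random combination with the powers of the seed, the
  kernel `eqPoly`, the chain of the messages), and **`verdict_iff_accept`**:
  `verdict τ ((queries τ).map πb) = true ↔ AlgebraicPCP.Accept H prm C (decodeProof πb) τ`;
* **encoding** (`§ Encoding`): `proofStr π`, the proof STRING of an abstract proof (the `pᵐ` words
  of `Y`, then the coefficient words of the messages key by key), with the reading lemmas
  `readF_proofStr_posY`, `readF_proofStr_posS`, `decodeProof_proofStr_Y`, `decodeProof_proofStr_S`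
  (for `p ≤ 2ᴮ`), and (`§ Transfer`) `accept_of_agree` / **`accept_decodeProof_proofStr`**:
  acceptance depends only on `Y` and on the messages of degree `≤ D` along prefixes shorter than
  `K`, so an accepted abstract proof stays accepted through its string (the completeness side).

## References

* L. Babai, L. Fortnow, L. Levin, M. Szegedy, *Checking computations in polylogarithmic time*,
  STOC 1991, §5 (the verifier: what is read, what is checked) [BFLS1991].
* L. Babai, L. Fortnow, C. Lund, *Non-deterministic exponential time has two-prover interactive
  protocols*, Comput. Complexity 1 (1991), §4–§7 [BabaiFortnowLund1991].
* S. Arora, B. Barak, *Computational Complexity: A Modern Approach*, CUP 2009, Def. 11.4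
  (nonadaptive verifiers: positions first, then a decision on the answer bits), §8.3.2, §8.6
  [AroraBarakCC2009].
-/

noncomputable section

open Finset Polynomial

namespace Literature.Computability.Complexity

namespace PCPBits

open AlgebraicPCP LowDegreeTest LowDegreeExtension SumcheckF

/-! ### Words and blocks -/

/-- **The `B`-bit little-endian word of `v`** (value `v mod 2ᴮ`). [cite: AroraBarakCC2009, §0.1] -/
def word : ℕ → ℕ → List Bool
  | 0, _ => []
  | B + 1, v => decide (v % 2 = 1) :: word B (v / 2)

/-- A word has the prescribed length. [folklore] -/
@[simp] theorem length_word : ∀ B v : ℕ, (word B v).length = B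
  | 0, _ => rfl
  | B + 1, v => by simp [word, length_word B]

/-- **The value of a word**: `⟦word B v⟧ = v mod 2ᴮ`. [folklore] -/
theorem bitsToNat_word : ∀ B v : ℕ, bitsToNat (word B v) = v % 2 ^ B
  | 0, v => by simp [word, Nat.mod_one]
  | B + 1, v => by
    rw [word, bitsToNat_cons, bitsToNat_word B, pow_succ', Nat.mod_mul]
    congr 1
    rcases Nat.mod_two_eq_zero_or_one v with h | h <;> simp [h]

/-- The value of a word of a small number is the number. [folklore] -/
theorem bitsToNat_word_of_lt {B v : ℕ} (hv : v < 2 ^ B) : bitsToNat (word B v) = v := by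
  rw [bitsToNat_word, Nat.mod_eq_of_lt hv]

/-- **The block of a bit oracle** at position `pos`: its `B` bits `πb pos, …, πb (pos + B - 1)`.
[cite: AroraBarakCC2009, Def. 11.4] -/
def blockAt (πb : ℕ → Bool) (pos B : ℕ) : List Bool := (List.range B).map fun i => πb (pos + i)

/-- A block has length `B`. [folklore] -/
@[simp] theorem length_blockAt (πb : ℕ → Bool) (pos B : ℕ) : (blockAt πb pos B).length = B := by
  simp [blockAt]

/-- **The number held by a block.** [folklore] -/
def readN (πb : ℕ → Bool) (pos B : ℕ) : ℕ := bitsToNat (blockAt πb pos B)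

/-- The number held by a block is `< 2ᴮ`. [folklore] -/
theorem readN_lt (πb : ℕ → Bool) (pos B : ℕ) : readN πb pos B < 2 ^ B := by
  simpa [readN] using bitsToNat_lt (blockAt πb pos B)

/-- **The field element held by a block** (its number, reduced modulo `p`). [cite: AroraBarakCC2009, §A.2.2] -/
def readF (p : ℕ) (πb : ℕ → Bool) (pos B : ℕ) : ZMod p := (readN πb pos B : ZMod p)

/-- The block of the bit oracle of a string `pre ++ w ++ post` at position `|pre|` is `w` (for
`|w| = B`). [folklore] -/
theorem blockAt_getD_append {pre w post : List Bool} {B : ℕ} (hw : w.length = B) :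
    blockAt (fun i => (pre ++ w ++ post).getD i false) pre.length B = w := by
  apply List.ext_getElem (by simp [hw])
  intro i h1 h2
  simp only [blockAt, List.getElem_map, List.getElem_range]
  rw [List.append_assoc, List.getD_eq_getElem?_getD, List.getElem?_append_right (by omega),
    Nat.add_sub_cancel_left, List.getElem?_append_left (by omega), List.getElem?_eq_getElem (by omega)]
  rfl

/-! ### Point indices -/

section Layout

variable (p : ℕ)

/-- **The index of a point** `z ∈ (ZMod p)ᵐ`: `∑ᵤ val zᵤ · pᵘ`. [cite: BFLS1991, §5 (the proof as a table)] -/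
def ptIdx {m : ℕ} (z : Fin m → ZMod p) : ℕ := DigitPoly.dval p fun u => (z u).val

section Idx

variable [NeZero p]

/-- Point indices are `< pᵐ`. [folklore] -/
theorem ptIdx_lt {m : ℕ} (z : Fin m → ZMod p) : ptIdx p z < p ^ m :=
  DigitPoly.dval_lt p _ fun u => ZMod.val_lt (z u)

/-- Point indices are injective. [folklore] -/
theorem ptIdx_injective (m : ℕ) : Function.Injective (ptIdx p (m := m)) := by
  intro z z' h
  have := DigitPoly.dval_injective p (fun u => ZMod.val_lt (z u)) (fun u => ZMod.val_lt (z' u)) h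
  funext u
  exact ZMod.val_injective p (congrFun this u)

/-- **The point with a given index** (digits of the index in base `p`). [folklore] -/
def idxPt (m i : ℕ) : Fin m → ZMod p := fun u => ((DigitPoly.digitsOf p (k := m) i u : ℕ) : ZMod p)

/-- The index of the point of an index `< pᵐ` is that index. [folklore] -/
theorem ptIdx_idxPt {m i : ℕ} (hi : i < p ^ m) : ptIdx p (idxPt p m i) = i := by
  have hp : 0 < p := Nat.pos_of_ne_zero (NeZero.ne p)
  unfold ptIdx idxPt
  have : (fun u : Fin m => (((DigitPoly.digitsOf p (k := m) i u : ℕ) : ZMod p)).val) = DigitPoly.digitsOf p (k := m) i := by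
    funext u
    rw [ZMod.val_natCast, Nat.mod_eq_of_lt (DigitPoly.digitsOf_lt hp i u)]
  rw [this, DigitPoly.dval_digitsOf hp hi]

/-- The point of the index of a point is that point. [folklore] -/
theorem idxPt_ptIdx {m : ℕ} (z : Fin m → ZMod p) : idxPt p m (ptIdx p z) = z :=
  ptIdx_injective p m (ptIdx_idxPt p (ptIdx_lt p z))

end Idx

/-! ### The proof layout -/

variable (B K m D : ℕ)

/-- **Position of the block of `Y z`.** [cite: BFLS1991, §5] -/
def posY (z : Fin m → ZMod p) : ℕ := B * ptIdx p z

/-- **Offset of the message table** (after the `pᵐ` blocks of `Y`). [cite: BFLS1991, §5] -/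
def offY : ℕ := B * p ^ m

/-- The index of a challenge prefix, padded with zeros to `K` digits. [folklore] -/
def prefIdx (pref : List (ZMod p)) : ℕ := DigitPoly.dval p fun j : Fin K => (pref.getD j 0).val

/-- **The key of a message**: `(ρ, seed, |pref|, pref)` as one number. [cite: BFLS1991, §5] -/
def msgKey (ρ : Fin K → ZMod p) (seed : ZMod p) (pref : List (ZMod p)) : ℕ :=
  ((ptIdx p ρ * p + seed.val) * K + pref.length) * p ^ K + prefIdx p K pref

/-- **Position of coefficient `j` of the message with key `msgKey ρ seed pref`.** [cite: BFLS1991, §5] -/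
def posS (ρ : Fin K → ZMod p) (seed : ZMod p) (pref : List (ZMod p)) (j : ℕ) : ℕ :=
  offY p B m + B * ((D + 1) * msgKey p K ρ seed pref + j)

/-- **The decoded message**: the polynomial with the `D + 1` coefficients read off the blocks.
[cite: AroraBarakCC2009, §8.3.2 (messages are degree-`D` polynomials, sent as coefficients)] -/
def decodeS (πb : ℕ → Bool) (ρ : Fin K → ZMod p) (seed : ZMod p) (pref : List (ZMod p)) : (ZMod p)[X] :=
  ∑ j ∈ range (D + 1), C (readF p πb (posS p B K m D ρ seed pref j) B) * X ^ j

/-- **Every bit oracle decodes to an abstract proof.** [cite: BFLS1991, §5] [cite: AroraBarakCC2009, Def. 11.4] -/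
def decodeProof [Fact p.Prime] (N : ℕ) (πb : ℕ → Bool) : Proof (ZMod p) K m N where
  Y z := readF p πb (posY p B m z) B
  S ρ seed pref := decodeS p B K m D πb ρ seed pref

/-- Decoded messages have degree `≤ D`. [folklore] -/
theorem natDegree_decodeS_le (πb : ℕ → Bool) (ρ : Fin K → ZMod p) (seed : ZMod p) (pref : List (ZMod p)) :
    (decodeS p B K m D πb ρ seed pref).natDegree ≤ D := by
  unfold decodeS
  refine (natDegree_sum_le _ _).trans (Finset.sup_le fun j hj => ?_)
  refine (natDegree_C_mul_X_pow_le _ _).trans ?_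
  have := mem_range.1 hj
  omega

/-- A polynomial with `D + 1` listed coefficients. [folklore] -/
def polyOfCoeffs (c : ℕ → ZMod p) : (ZMod p)[X] := ∑ j ∈ range (D + 1), C (c j) * X ^ j

/-- The decoded message is the polynomial of the read coefficients. [folklore] -/
theorem decodeS_eq_polyOfCoeffs (πb : ℕ → Bool) (ρ : Fin K → ZMod p) (seed : ZMod p) (pref : List (ZMod p)) :
    decodeS p B K m D πb ρ seed pref = polyOfCoeffs p D fun j => readF p πb (posS p B K m D ρ seed pref j) B :=
  rfl

end Layout

/-! ### The tape layout -/

section TapeLayout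

variable {F : Type*} [Field F] {K m : ℕ} (C : CSP F K m) (T Q : ℕ) (e : C.Qry ≃ Fin Q)

/-- **Length of the tape tuple**: `K` (point `ρ`) `+ 1` (seed) `+ K` (challenges) `+ T · 2m` (test
pairs) `+ Q · m` (directions). [cite: BFLS1991, §5] -/
def tapeLen (K m T Q : ℕ) : ℕ := K + 1 + K + T * (2 * m) + Q * m

variable {C T Q}

/-- Index bound: the `ρ` block. [folklore] -/
theorem idx_rho_lt {i : ℕ} (hi : i < K) : i < tapeLen K m T Q := by simp only [tapeLen]; omega
/-- Index bound: the seed. [folklore] -/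
theorem idx_seed_lt : K < tapeLen K m T Q := by simp only [tapeLen]; omega
/-- Index bound: the challenge block. [folklore] -/
theorem idx_r_lt {i : ℕ} (hi : i < K) : K + 1 + i < tapeLen K m T Q := by simp only [tapeLen]; omega
/-- Index bound: the test block. [folklore] -/
theorem idx_test_lt {i u : ℕ} (hi : i < T) (hu : u < 2 * m) : K + 1 + K + (i * (2 * m) + u) < tapeLen K m T Q := by
  simp only [tapeLen]
  have : i * (2 * m) + u < T * (2 * m) := by
    calc i * (2 * m) + u < i * (2 * m) + 2 * m := by omega
      _ = (i + 1) * (2 * m) := by ring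
      _ ≤ T * (2 * m) := Nat.mul_le_mul_right _ hi
  omega
/-- Index bound: the direction block. [folklore] -/
theorem idx_dir_lt {k u : ℕ} (hk : k < Q) (hu : u < m) : K + 1 + K + T * (2 * m) + (k * m + u) < tapeLen K m T Q := by
  simp only [tapeLen]
  have : k * m + u < Q * m := by
    calc k * m + u < k * m + m := by omega
      _ = (k + 1) * m := by ring
      _ ≤ Q * m := Nat.mul_le_mul_right _ hk
  omega

variable (C T Q)

/-- **The structured tape of a tuple** `t ∈ F^{tapeLen}`: `ρ = t[0, K)`, `seed = t[K]`,
`r = t[K+1, 2K+1)`, test `i` = the pair of points at `2K+1 + 2mi`, direction of query `q` = the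
point at `2K+1 + 2mT + m · e q`. [cite: BFLS1991, §5] -/
def tapeOf (t : Fin (tapeLen K m T Q) → F) : Tape F C T where
  ρ i := t ⟨i, idx_rho_lt i.isLt⟩
  seed := t ⟨K, idx_seed_lt⟩
  r i := t ⟨K + 1 + i, idx_r_lt i.isLt⟩
  tests i := (fun u => t ⟨K + 1 + K + (i * (2 * m) + u), idx_test_lt i.isLt (by omega)⟩,
    fun u => t ⟨K + 1 + K + (i * (2 * m) + (m + u)), idx_test_lt i.isLt (by omega)⟩)
  dirs q := fun u => t ⟨K + 1 + K + T * (2 * m) + ((e q : ℕ) * m + u), idx_dir_lt (e q).isLt u.isLt⟩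

/-- **The tuple of a structured tape** (inverse of `tapeOf`). [folklore] -/
def tupleOf (τ : Tape F C T) (i : Fin (tapeLen K m T Q)) : F :=
  if h₁ : (i : ℕ) < K then τ.ρ ⟨i, h₁⟩
  else if h₂ : (i : ℕ) = K then τ.seed
  else if h₃ : (i : ℕ) < K + 1 + K then τ.r ⟨i - (K + 1), by omega⟩
  else if h₄ : (i : ℕ) < K + 1 + K + T * (2 * m) then
    have hm : 0 < 2 * m := Nat.pos_of_mul_pos_left (show 0 < T * (2 * m) by omega)
    have hblk : ((i : ℕ) - (K + 1 + K)) / (2 * m) < T :=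
      Nat.div_lt_of_lt_mul (by rw [Nat.mul_comm (2 * m) T]; omega)
    if h₅ : ((i : ℕ) - (K + 1 + K)) % (2 * m) < m then
      (τ.tests ⟨((i : ℕ) - (K + 1 + K)) / (2 * m), hblk⟩).1 ⟨((i : ℕ) - (K + 1 + K)) % (2 * m), h₅⟩
    else (τ.tests ⟨((i : ℕ) - (K + 1 + K)) / (2 * m), hblk⟩).2
      ⟨((i : ℕ) - (K + 1 + K)) % (2 * m) - m, by have := Nat.mod_lt ((i : ℕ) - (K + 1 + K)) hm; omega⟩
  else
    have hi' : (i : ℕ) - (K + 1 + K + T * (2 * m)) < Q * m := by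
      have := i.isLt; simp only [tapeLen] at this; omega
    have hm : 0 < m := Nat.pos_of_mul_pos_left (lt_of_le_of_lt (Nat.zero_le _) hi')
    τ.dirs (e.symm ⟨((i : ℕ) - (K + 1 + K + T * (2 * m))) / m,
        Nat.div_lt_of_lt_mul (by rwa [Nat.mul_comm Q m] at hi')⟩)
      ⟨((i : ℕ) - (K + 1 + K + T * (2 * m))) % m, Nat.mod_lt _ hm⟩

/-- `tapeOf (tupleOf τ) = τ`. [folklore] -/
theorem tapeOf_tupleOf (τ : Tape F C T) : tapeOf C T Q e (tupleOf C T Q e τ) = τ := by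
  obtain ⟨ρ, seed, r, tests, dirs⟩ := τ
  simp only [tapeOf, tupleOf]
  congr 1
  · funext i; simp [i.isLt]
  · simp
  · funext ⟨i, hi⟩
    have h1 : ¬ (K + 1 + i < K) := by omega
    have h2 : ¬ (K + 1 + i = K) := by omega
    have h3 : K + 1 + i < K + 1 + K := by omega
    simp only [h1, h2, h3, ↓reduceDIte, Nat.add_sub_cancel_left]
  · funext ⟨i, hi⟩
    have hm2 : ∀ u : ℕ, u < 2 * m → i * (2 * m) + u < T * (2 * m) := fun u hu => by
      calc i * (2 * m) + u < i * (2 * m) + 2 * m := by omega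
        _ = (i + 1) * (2 * m) := by ring
        _ ≤ T * (2 * m) := Nat.mul_le_mul_right _ hi
    refine Prod.ext ?_ ?_
    · funext ⟨u, hu'⟩
      have hu : u < 2 * m := by omega
      have h1 : ¬ (K + 1 + K + (i * (2 * m) + u) < K) := by omega
      have h2 : ¬ (K + 1 + K + (i * (2 * m) + u) = K) := by omega
      have h3 : ¬ (K + 1 + K + (i * (2 * m) + u) < K + 1 + K) := by omega
      have h4 : K + 1 + K + (i * (2 * m) + u) < K + 1 + K + T * (2 * m) := by have := hm2 u hu; omega
      obtain ⟨k1, k2⟩ := div_mod_block (k := i) hu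
      simp only [h1, h2, h3, h4, ↓reduceDIte, Nat.add_sub_cancel_left, k1, k2, hu']
    · funext ⟨u, hu'⟩
      have hu : m + u < 2 * m := by omega
      have h1 : ¬ (K + 1 + K + (i * (2 * m) + (m + u)) < K) := by omega
      have h2 : ¬ (K + 1 + K + (i * (2 * m) + (m + u)) = K) := by omega
      have h3 : ¬ (K + 1 + K + (i * (2 * m) + (m + u)) < K + 1 + K) := by omega
      have h4 : K + 1 + K + (i * (2 * m) + (m + u)) < K + 1 + K + T * (2 * m) := by have := hm2 _ hu; omega
      obtain ⟨k1, k2⟩ := div_mod_block (k := i) hu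
      have h5 : ¬ (m + u < m) := by omega
      simp only [h1, h2, h3, h4, ↓reduceDIte, Nat.add_sub_cancel_left, k1, k2, h5]
  · funext q ⟨u, hum⟩
    have hkm : (e q : ℕ) * m + u < Q * m := by
      calc (e q : ℕ) * m + u < (e q : ℕ) * m + m := by omega
        _ = ((e q : ℕ) + 1) * m := by ring
        _ ≤ Q * m := Nat.mul_le_mul_right _ (e q).isLt
    have h1 : ¬ (K + 1 + K + T * (2 * m) + ((e q : ℕ) * m + u) < K) := by omega
    have h2 : ¬ (K + 1 + K + T * (2 * m) + ((e q : ℕ) * m + u) = K) := by omega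
    have h3 : ¬ (K + 1 + K + T * (2 * m) + ((e q : ℕ) * m + u) < K + 1 + K) := by omega
    have h4 : ¬ (K + 1 + K + T * (2 * m) + ((e q : ℕ) * m + u) < K + 1 + K + T * (2 * m)) := by omega
    obtain ⟨k1, k2⟩ := div_mod_block (k := (e q : ℕ)) hum
    simp only [h1, h2, h3, h4, ↓reduceDIte, Nat.add_sub_cancel_left, k1, k2, Fin.eta, Equiv.symm_apply_apply]

/-- `tupleOf (tapeOf t) = t`. [folklore] -/
theorem tupleOf_tapeOf (t : Fin (tapeLen K m T Q) → F) : tupleOf C T Q e (tapeOf C T Q e t) = t := by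
  funext i
  simp only [tupleOf, tapeOf]
  split_ifs with h₁ h₂ h₃ h₄ h₅
  · rfl
  · congr 1; exact Fin.ext h₂.symm
  · congr 1; apply Fin.ext; simp only; omega
  · congr 1
    apply Fin.ext
    have := Nat.div_add_mod' ((i : ℕ) - (K + 1 + K)) (2 * m)
    simp only
    omega
  · congr 1
    apply Fin.ext
    have hm : 0 < 2 * m := Nat.pos_of_ne_zero fun h0 => by rw [h0, Nat.mul_zero] at h₄; omega
    have := Nat.div_add_mod' ((i : ℕ) - (K + 1 + K)) (2 * m)
    have := Nat.mod_lt ((i : ℕ) - (K + 1 + K)) hm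
    simp only
    omega
  · simp only [Equiv.apply_symm_apply]
    congr 1
    apply Fin.ext
    have := Nat.div_add_mod' ((i : ℕ) - (K + 1 + K + T * (2 * m))) m
    have hlt := i.isLt
    simp only [tapeLen] at hlt
    simp only
    omega

/-- **The tape map is a bijection** `F^{tapeLen} → Tape F C T`. [folklore] -/
theorem tapeOf_bijective : Function.Bijective (tapeOf C T Q e) :=
  ⟨fun t t' h => by rw [← tupleOf_tapeOf C T Q e t, h, tupleOf_tapeOf],
    fun τ => ⟨tupleOf C T Q e τ, tapeOf_tupleOf C T Q e τ⟩⟩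

end TapeLayout

/-! ### List plumbing: blocks of a concatenation of equal-length pieces -/

section Plumbing

variable {α β : Type*}

/-- **Indexing a concatenation of pieces of constant length `c`**: item `i · c + a` is item `a` of
piece `i`. [folklore] -/
theorem getD_flatMap_const (g : α → List β) {c : ℕ} (hg : ∀ a, (g a).length = c) (d : β) (d' : α) :
    ∀ (l : List α) {i a : ℕ}, i < l.length → a < c → (l.flatMap g).getD (i * c + a) d = (g (l.getD i d')).getD a d
  | [], i, a, hi, _ => absurd hi (Nat.not_lt_zero _)
  | x :: l, 0, a, _, ha => by
    rw [List.flatMap_cons, Nat.zero_mul, Nat.zero_add, List.getD_cons_zero, List.getD_append _ _ _ _ (by rw [hg]; exact ha)]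
  | x :: l, i + 1, a, hi, ha => by
    have hle : (g x).length ≤ (i + 1) * c + a := by rw [hg, Nat.succ_mul]; omega
    rw [List.flatMap_cons, List.getD_cons_succ, List.getD_append_right _ _ _ _ hle, hg,
      show (i + 1) * c + a - c = i * c + a by rw [Nat.succ_mul]; omega]
    exact getD_flatMap_const g hg d d' l (by simpa using hi) ha

/-- **The `k`-th block of a concatenation of pieces of constant length `c`** is piece `k`. [folklore] -/
theorem drop_take_flatMap_const (g : α → List β) {c : ℕ} (hg : ∀ a, (g a).length = c) (d' : α) :
    ∀ (l : List α) {k : ℕ}, k < l.length → ((l.flatMap g).drop (k * c)).take c = g (l.getD k d')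
  | [], k, hk => absurd hk (Nat.not_lt_zero _)
  | x :: l, 0, _ => by
    rw [List.flatMap_cons, Nat.zero_mul, List.drop_zero, List.getD_cons_zero, List.take_append_of_le_length (by rw [hg]),
      ← hg x, List.take_length]
  | x :: l, k + 1, hk => by
    rw [List.flatMap_cons, List.getD_cons_succ, List.drop_append, hg x,
      List.drop_eq_nil_of_le (as := g x) (i := (k + 1) * c) (by rw [hg, Nat.succ_mul]; omega), List.nil_append,
      show (k + 1) * c - c = k * c by rw [Nat.succ_mul]; omega]
    exact drop_take_flatMap_const g hg d' l (by simpa using hk)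

/-- Length of a concatenation of pieces of constant length. [folklore] -/
theorem length_flatMap_const (g : α → List β) {c : ℕ} (hg : ∀ a, (g a).length = c) (l : List α) :
    (l.flatMap g).length = l.length * c := by
  induction l with
  | nil => simp
  | cons x l ih => rw [List.flatMap_cons, List.length_append, ih, hg, List.length_cons, Nat.succ_mul, Nat.add_comm]

/-- Indexing an appended list on the right. [folklore] -/
theorem getD_append_right' (l₁ l₂ : List α) (d : α) (i : ℕ) : (l₁ ++ l₂).getD (l₁.length + i) d = l₂.getD i d := by
  rw [List.getD_append_right _ _ _ _ (Nat.le_add_right _ _), Nat.add_sub_cancel_left]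

/-- Indexing a mapped list inside its range (any defaults). [folklore] -/
theorem getD_map_of_lt (g : α → β) (l : List α) {i : ℕ} (hi : i < l.length) (d : β) (d' : α) :
    (l.map g).getD i d = g (l.getD i d') := by
  rw [List.getD_eq_getElem _ _ (by simpa using hi), List.getElem_map, List.getD_eq_getElem _ _ hi]

/-- Indexing `finRange`. [folklore] -/
theorem getD_finRange {n : ℕ} (i d : Fin n) : (List.finRange n).getD i d = i := by
  rw [List.getD_eq_getElem _ _ (by simp)]
  simp

/-- Indexing `range`. [folklore] -/
theorem getD_range {n i : ℕ} (hi : i < n) (d : ℕ) : (List.range n).getD i d = i := by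
  rw [List.getD_eq_getElem _ _ (by simpa using hi), List.getElem_range]

/-- Indexing `(range n).map f`. [folklore] -/
theorem getD_map_range {γ : Type*} (f : ℕ → γ) {n a : ℕ} (ha : a < n) (d : γ) : ((List.range n).map f).getD a d = f a := by
  rw [getD_map_of_lt f _ (by simpa using ha) d 0, getD_range ha]

/-- Indexing `(finRange n).map f`. [folklore] -/
theorem getD_map_finRange {γ : Type*} {n : ℕ} (f : Fin n → γ) (i : Fin n) (d : γ) : ((List.finRange n).map f).getD i d = f i := by
  rw [getD_map_of_lt f _ (by simp) d i, getD_finRange]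

end Plumbing

/-! ### The queries -/

section Queries

variable (p : ℕ) [Fact p.Prime] (B : ℕ) {K m : ℕ} (C : CSP (ZMod p) K m) (prm : Params) {Q : ℕ} (e : C.Qry ≃ Fin Q)

/-- **The points of the low-degree tests**: test `i`, node `a ↦ xᵢ + a • tᵢ`. [cite: RubinfeldSudan1996, §4] -/
def rsPoint (τ : Tape (ZMod p) C prm.T) (i : Fin prm.T) (a : ℕ) : Fin m → ZMod p :=
  (τ.tests i).1 + (a : ZMod p) • (τ.tests i).2

/-- **The points of the self-corrected reads**: query `q`, node `s ↦ addr_q(r) + (s+1) • dir_q`.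
[cite: AroraBarakCC2009, §8.6.2] -/
def scPoint (τ : Tape (ZMod p) C prm.T) (q : C.Qry) (s : Fin (prm.d + 1)) : Fin m → ZMod p :=
  readAddr ((C.fam q.1).addr q.2) τ.r + scNode (F := ZMod p) prm.d s • τ.dirs q

/-- The list of test points. [folklore] -/
def rsPoints (τ : Tape (ZMod p) C prm.T) : List (Fin m → ZMod p) :=
  (List.finRange prm.T).flatMap fun i => (List.range (prm.d + 2)).map fun a => rsPoint p C prm τ i a

/-- The list of correction points. [folklore] -/
def scPoints (τ : Tape (ZMod p) C prm.T) : List (Fin m → ZMod p) :=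
  (List.finRange Q).flatMap fun k => (List.finRange (prm.d + 1)).map fun s => scPoint p C prm τ (e.symm k) s

/-- **The `Y`-points read**, in order: the `T(d+2)` test points, then the `Q(d+1)` correction points.
[cite: BFLS1991, §5] -/
def yPoints (τ : Tape (ZMod p) C prm.T) : List (Fin m → ZMod p) := rsPoints p C prm τ ++ scPoints p C prm e τ

/-- **The message blocks read**: for round `i < K` and coefficient `j ≤ D`, the block of coefficient
`j` of the message along the challenge prefix of length `i`. [cite: BFLS1991, §5] -/
def msgPos (τ : Tape (ZMod p) C prm.T) : List ℕ :=
  (List.range K).flatMap fun i => (List.range (prm.D + 1)).map fun j =>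
    posS p B K m prm.D τ.ρ τ.seed ((List.ofFn τ.r).take i) j

/-- **The block positions read**: the blocks of the `Y`-points, then the message blocks. [cite: BFLS1991, §5] -/
def blockPos (τ : Tape (ZMod p) C prm.T) : List ℕ :=
  (yPoints p C prm e τ).map (posY p B m) ++ msgPos p B C prm τ

/-- **The queried bit positions**: every block position expanded to its `B` consecutive bits.
[cite: AroraBarakCC2009, Def. 11.4] -/
def queries (τ : Tape (ZMod p) C prm.T) : List ℕ :=
  (blockPos p B C prm e τ).flatMap fun pos => (List.range B).map (pos + ·)

/-- The number of test points. [folklore] -/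
theorem length_rsPoints (τ : Tape (ZMod p) C prm.T) : (rsPoints p C prm τ).length = prm.T * (prm.d + 2) := by
  unfold rsPoints
  rw [length_flatMap_const _ (c := prm.d + 2) (fun _ => by simp), List.length_finRange]

/-- The number of correction points. [folklore] -/
theorem length_scPoints (τ : Tape (ZMod p) C prm.T) : (scPoints p C prm e τ).length = Q * (prm.d + 1) := by
  unfold scPoints
  rw [length_flatMap_const _ (c := prm.d + 1) (fun _ => by simp), List.length_finRange]

/-- The number of `Y`-points. [folklore] -/
theorem length_yPoints (τ : Tape (ZMod p) C prm.T) :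
    (yPoints p C prm e τ).length = prm.T * (prm.d + 2) + Q * (prm.d + 1) := by
  unfold yPoints
  rw [List.length_append, length_rsPoints, length_scPoints]

/-- The number of message blocks. [folklore] -/
theorem length_msgPos (τ : Tape (ZMod p) C prm.T) : (msgPos p B C prm τ).length = K * (prm.D + 1) := by
  unfold msgPos
  rw [length_flatMap_const _ (c := prm.D + 1) (fun _ => by simp), List.length_range]

/-- The number of blocks read. [folklore] -/
theorem length_blockPos (τ : Tape (ZMod p) C prm.T) :
    (blockPos p B C prm e τ).length = prm.T * (prm.d + 2) + Q * (prm.d + 1) + K * (prm.D + 1) := by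
  unfold blockPos
  rw [List.length_append, List.length_map, length_yPoints, length_msgPos]

/-- **The number of queried bits.** [cite: AroraBarakCC2009, Def. 11.4] -/
theorem length_queries (τ : Tape (ZMod p) C prm.T) :
    (queries p B C prm e τ).length = (prm.T * (prm.d + 2) + Q * (prm.d + 1) + K * (prm.D + 1)) * B := by
  unfold queries
  rw [length_flatMap_const _ (c := B) (fun _ => by simp), length_blockPos]

/-- **The value of the `k`-th answer block**, as a field element. [cite: AroraBarakCC2009, Def. 11.4] -/
def ansVal (ans : List Bool) (k : ℕ) : ZMod p := ((bitsToNat ((ans.drop (k * B)).take B) : ℕ) : ZMod p)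

/-- **Reading lemma**: the `k`-th block of the answers is the field element of the bit oracle at the
`k`-th block position. [cite: AroraBarakCC2009, Def. 11.4 (nonadaptivity)] -/
theorem ansVal_queries_map (τ : Tape (ZMod p) C prm.T) (πb : ℕ → Bool) {k : ℕ}
    (hk : k < (blockPos p B C prm e τ).length) :
    ansVal p B ((queries p B C prm e τ).map πb) k = readF p πb ((blockPos p B C prm e τ).getD k 0) B := by
  unfold ansVal readF readN queries
  rw [List.map_flatMap]
  have hg : ∀ pos : ℕ, (((List.range B).map (pos + ·)).map πb).length = B := fun _ => by simp
  rw [drop_take_flatMap_const (fun pos => ((List.range B).map (pos + ·)).map πb) hg 0 _ hk]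
  simp only [List.map_map, blockAt]
  rfl

/-- **Block position of test `i`, node `a`.** [folklore] -/
theorem getD_blockPos_rs (τ : Tape (ZMod p) C prm.T) (i : Fin prm.T) {a : ℕ} (ha : a < prm.d + 2) :
    (blockPos p B C prm e τ).getD ((i : ℕ) * (prm.d + 2) + a) 0 = posY p B m (rsPoint p C prm τ i a) := by
  have hlt : (i : ℕ) * (prm.d + 2) + a < prm.T * (prm.d + 2) := by
    calc (i : ℕ) * (prm.d + 2) + a < (i : ℕ) * (prm.d + 2) + (prm.d + 2) := by omega
      _ = ((i : ℕ) + 1) * (prm.d + 2) := by ring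
      _ ≤ prm.T * (prm.d + 2) := Nat.mul_le_mul_right _ i.isLt
  unfold blockPos yPoints
  rw [List.getD_append _ _ _ _ (by rw [List.length_map, List.length_append, length_rsPoints]; omega),
    getD_map_of_lt _ _ (by rw [List.length_append, length_rsPoints]; omega) 0 (0 : Fin m → ZMod p),
    List.getD_append _ _ _ _ (by rw [length_rsPoints]; exact hlt), rsPoints,
    getD_flatMap_const _ (c := prm.d + 2) (fun _ => by simp) (0 : Fin m → ZMod p) i _ (by simp) ha,
    getD_finRange, getD_map_range _ ha]

/-- **Block position of the correction read of query `e⁻¹ k`, node `s`.** [folklore] -/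
theorem getD_blockPos_sc (τ : Tape (ZMod p) C prm.T) (k : Fin Q) (s : Fin (prm.d + 1)) :
    (blockPos p B C prm e τ).getD (prm.T * (prm.d + 2) + ((k : ℕ) * (prm.d + 1) + s)) 0 =
      posY p B m (scPoint p C prm τ (e.symm k) s) := by
  have hlt : (k : ℕ) * (prm.d + 1) + s < Q * (prm.d + 1) := by
    calc (k : ℕ) * (prm.d + 1) + s < (k : ℕ) * (prm.d + 1) + (prm.d + 1) := by omega
      _ = ((k : ℕ) + 1) * (prm.d + 1) := by ring
      _ ≤ Q * (prm.d + 1) := Nat.mul_le_mul_right _ k.isLt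
  unfold blockPos yPoints
  rw [List.getD_append _ _ _ _ (by rw [List.length_map, List.length_append, length_rsPoints, length_scPoints]; omega),
    getD_map_of_lt _ _ (by rw [List.length_append, length_rsPoints, length_scPoints]; omega) 0 (0 : Fin m → ZMod p),
    ← length_rsPoints p C prm τ, getD_append_right', scPoints,
    getD_flatMap_const _ (c := prm.d + 1) (fun _ => by simp) (0 : Fin m → ZMod p) k _ (by simp) s.isLt,
    getD_finRange, getD_map_finRange]

/-- **Block position of coefficient `j` of the round-`i` message.** [folklore] -/
theorem getD_blockPos_msg (τ : Tape (ZMod p) C prm.T) {i : ℕ} (hi : i < K) {j : ℕ} (hj : j < prm.D + 1) :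
    (blockPos p B C prm e τ).getD (prm.T * (prm.d + 2) + Q * (prm.d + 1) + (i * (prm.D + 1) + j)) 0 =
      posS p B K m prm.D τ.ρ τ.seed ((List.ofFn τ.r).take i) j := by
  unfold blockPos
  rw [← length_yPoints p C prm e τ, ← List.length_map (f := posY p B m), getD_append_right', msgPos,
    getD_flatMap_const _ (c := prm.D + 1) (fun _ => by simp) 0 0 _ (by simpa using hi) hj, getD_range hi,
    getD_map_range _ hj]

end Queries

/-! ### The verdict -/

section Verdict

variable (p : ℕ) [Fact p.Prime] (B : ℕ) {K m : ℕ} (H : Finset (ZMod p)) (C : CSP (ZMod p) K m) (prm : Params)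
  {Q : ℕ} (e : C.Qry ≃ Fin Q)

/-- **The self-correction weights**: the Lagrange basis polynomial of node `s + 1` (nodes `1, …, d+1`)
at `0`, so that `selfCorrect d f z t = ∑ₛ scWeight d s · f (z + (s+1) • t)`.
[cite: GLRSW1991, §3] [cite: AroraBarakCC2009, §8.6.2] -/
def scWeight (d : ℕ) (s : Fin (d + 1)) : ZMod p := (Lagrange.basis Finset.univ (scNode (F := ZMod p) d) s).eval 0

/-- The self-corrector is the weighted sum of the `d + 1` line values. [cite: GLRSW1991, §3] -/
theorem selfCorrect_eq_sum (d : ℕ) (f : (Fin m → ZMod p) → ZMod p) (z t : Fin m → ZMod p) :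
    selfCorrect d f z t = ∑ s : Fin (d + 1), scWeight p d s * f (z + scNode (F := ZMod p) d s • t) := by
  unfold selfCorrect LineCorrect.correctVal scWeight
  rw [Lagrange.interpolate_apply, eval_finsetSum]
  refine sum_congr rfl fun s _ => ?_
  rw [eval_mul, eval_C, mul_comm]

/-- Test value `a` of test `i`, read off the answers. [folklore] -/
def rsVal (ans : List Bool) (i : Fin prm.T) (a : ℕ) : ZMod p := ansVal p B ans ((i : ℕ) * (prm.d + 2) + a)

/-- Line value `s` of the correction read `k`, read off the answers. [folklore] -/
def scRead (ans : List Bool) (k : Fin Q) (s : Fin (prm.d + 1)) : ZMod p :=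
  ansVal p B ans (prm.T * (prm.d + 2) + ((k : ℕ) * (prm.d + 1) + s))

/-- Coefficient `j` of the round-`i` message, read off the answers. [folklore] -/
def coeffRead (Q : ℕ) (ans : List Bool) (i j : ℕ) : ZMod p :=
  ansVal p B ans (prm.T * (prm.d + 2) + Q * (prm.d + 1) + (i * (prm.D + 1) + j))

/-- **The round-`i` message read off the answers.** [cite: AroraBarakCC2009, §8.3.2] -/
def msgRead (Q : ℕ) (ans : List Bool) (i : ℕ) : (ZMod p)[X] := polyOfCoeffs p prm.D (coeffRead p B prm Q ans i)

/-- **The self-corrected value of read `k`.** [cite: AroraBarakCC2009, §8.6.2] -/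
def scV (ans : List Bool) (k : Fin Q) : ZMod p := ∑ s : Fin (prm.d + 1), scWeight p prm.d s * scRead p B prm ans k s

/-- **The chain of claimed sumcheck values**, recomputed from the read messages: `v₀ = 0`,
`vᵢ₊₁ = sᵢ(rᵢ)`. [cite: AroraBarakCC2009, §8.3.2] -/
def chainV (Q : ℕ) (ans : List Bool) (τ : Tape (ZMod p) C prm.T) : ℕ → ZMod p
  | 0 => 0
  | i + 1 => (msgRead p B prm Q ans i).eval ((List.ofFn τ.r).getD i 0)

/-- **The verifier's value of the sumcheck summand at the final point** (random combination of the
constraint values on the corrected reads, times the kernel). [cite: BFLS1991, §5] -/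
def finalV (ans : List Bool) (τ : Tape (ZMod p) C prm.T) : ZMod p :=
  (∑ φ : Fin C.N, τ.lam φ * (C.fam φ).value τ.r fun j => scV p B prm ans (e ⟨φ, j⟩)) * ∏ t, eqPoly H (τ.r t) (τ.ρ t)

/-- **The checks**, as a proposition on the tape and the answer bits: all finite-difference test sums
vanish, every read message sums over `H` to the current chain value, and the final value matches.
[cite: BFLS1991, §5] [cite: AroraBarakCC2009, §8.3.2, §8.6] -/
def PassProp (τ : Tape (ZMod p) C prm.T) (ans : List Bool) : Prop :=
  (∀ i : Fin prm.T, ∑ a ∈ range (prm.d + 2), diffCoeff prm.d a * rsVal p B prm ans i a = 0) ∧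
  (∀ i : Fin K, ∑ a ∈ H, (msgRead p B prm Q ans i).eval a = chainV p B C prm Q ans τ i) ∧
  finalV p B H C prm e ans τ = chainV p B C prm Q ans τ K

/-- **The verdict** (the decision bit). [cite: AroraBarakCC2009, Def. 11.4] -/
def verdict (τ : Tape (ZMod p) C prm.T) (ans : List Bool) : Bool :=
  @decide (PassProp p B H C prm e τ ans) (Classical.dec _)

/-- Unfolding the verdict. [folklore] -/
theorem verdict_eq_true_iff (τ : Tape (ZMod p) C prm.T) (ans : List Bool) :
    verdict p B H C prm e τ ans = true ↔ PassProp p B H C prm e τ ans := by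
  unfold verdict
  exact @decide_eq_true_iff _ (Classical.dec _)

/-! ### The verdict on the true answers is acceptance of the decoded proof -/

variable {p B H C prm e}

/-- Test values are the decoded oracle at the test points. [folklore] -/
theorem rsVal_queries (τ : Tape (ZMod p) C prm.T) (πb : ℕ → Bool) (i : Fin prm.T) {a : ℕ} (ha : a < prm.d + 2) :
    rsVal p B prm ((queries p B C prm e τ).map πb) i a = (decodeProof p B K m prm.D C.N πb).Y (rsPoint p C prm τ i a) := by
  unfold rsVal
  have hk : (i : ℕ) * (prm.d + 2) + a < (blockPos p B C prm e τ).length := by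
    rw [length_blockPos]
    have : (i : ℕ) * (prm.d + 2) + a < prm.T * (prm.d + 2) := by
      calc (i : ℕ) * (prm.d + 2) + a < (i : ℕ) * (prm.d + 2) + (prm.d + 2) := by omega
        _ = ((i : ℕ) + 1) * (prm.d + 2) := by ring
        _ ≤ prm.T * (prm.d + 2) := Nat.mul_le_mul_right _ i.isLt
    omega
  rw [ansVal_queries_map p B C prm e τ πb hk, getD_blockPos_rs p B C prm e τ i ha]
  rfl

/-- Line values are the decoded oracle at the correction points. [folklore] -/
theorem scRead_queries (τ : Tape (ZMod p) C prm.T) (πb : ℕ → Bool) (k : Fin Q) (s : Fin (prm.d + 1)) :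
    scRead p B prm ((queries p B C prm e τ).map πb) k s =
      (decodeProof p B K m prm.D C.N πb).Y (scPoint p C prm τ (e.symm k) s) := by
  unfold scRead
  have hk : prm.T * (prm.d + 2) + ((k : ℕ) * (prm.d + 1) + s) < (blockPos p B C prm e τ).length := by
    rw [length_blockPos]
    have : (k : ℕ) * (prm.d + 1) + s < Q * (prm.d + 1) := by
      calc (k : ℕ) * (prm.d + 1) + s < (k : ℕ) * (prm.d + 1) + (prm.d + 1) := by omega
        _ = ((k : ℕ) + 1) * (prm.d + 1) := by ring
        _ ≤ Q * (prm.d + 1) := Nat.mul_le_mul_right _ k.isLt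
    omega
  rw [ansVal_queries_map p B C prm e τ πb hk, getD_blockPos_sc p B C prm e τ k s]
  rfl

/-- Coefficients are the read coefficients of the decoded message. [folklore] -/
theorem coeffRead_queries (τ : Tape (ZMod p) C prm.T) (πb : ℕ → Bool) {i : ℕ} (hi : i < K) {j : ℕ} (hj : j < prm.D + 1) :
    coeffRead p B prm Q ((queries p B C prm e τ).map πb) i j =
      readF p πb (posS p B K m prm.D τ.ρ τ.seed ((List.ofFn τ.r).take i) j) B := by
  unfold coeffRead
  have hk : prm.T * (prm.d + 2) + Q * (prm.d + 1) + (i * (prm.D + 1) + j) < (blockPos p B C prm e τ).length := by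
    rw [length_blockPos]
    have : i * (prm.D + 1) + j < K * (prm.D + 1) := by
      calc i * (prm.D + 1) + j < i * (prm.D + 1) + (prm.D + 1) := by omega
        _ = (i + 1) * (prm.D + 1) := by ring
        _ ≤ K * (prm.D + 1) := Nat.mul_le_mul_right _ hi
    omega
  rw [ansVal_queries_map p B C prm e τ πb hk, getD_blockPos_msg p B C prm e τ hi hj]

/-- **The read messages are the messages of the decoded proof along the actual challenges.** [folklore] -/
theorem msgRead_queries (τ : Tape (ZMod p) C prm.T) (πb : ℕ → Bool) {i : ℕ} (hi : i < K) :
    msgRead p B prm Q ((queries p B C prm e τ).map πb) i = msgs prm C (decodeProof p B K m prm.D C.N πb) τ i := by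
  show polyOfCoeffs p prm.D _ = decodeS p B K m prm.D πb τ.ρ τ.seed ((List.ofFn τ.r).take i)
  rw [decodeS_eq_polyOfCoeffs]
  unfold polyOfCoeffs
  refine sum_congr rfl fun j hj => ?_
  rw [coeffRead_queries τ πb hi (mem_range.1 hj)]

/-- The recomputed chain is the chain of the decoded messages. [folklore] -/
theorem chainV_queries (τ : Tape (ZMod p) C prm.T) (πb : ℕ → Bool) :
    ∀ {i : ℕ}, i ≤ K → chainV p B C prm Q ((queries p B C prm e τ).map πb) τ i =
      chain 0 (msgs prm C (decodeProof p B K m prm.D C.N πb) τ) (List.ofFn τ.r) i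
  | 0, _ => rfl
  | i + 1, hi => by
    show (msgRead p B prm Q _ i).eval _ = (msgs prm C _ τ i).eval _
    rw [msgRead_queries τ πb (by omega)]

/-- The self-corrected read values are those of the decoded proof. [folklore] -/
theorem scV_queries (τ : Tape (ZMod p) C prm.T) (πb : ℕ → Bool) (q : C.Qry) :
    scV p B prm ((queries p B C prm e τ).map πb) (e q) = scVal prm C (decodeProof p B K m prm.D C.N πb) τ q := by
  unfold scV scVal
  rw [selfCorrect_eq_sum]
  refine sum_congr rfl fun s _ => ?_
  rw [scRead_queries, Equiv.symm_apply_apply]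
  rfl

/-- The recomputed final value is the final value of the decoded proof. [folklore] -/
theorem finalV_queries (τ : Tape (ZMod p) C prm.T) (πb : ℕ → Bool) :
    finalV p B H C prm e ((queries p B C prm e τ).map πb) τ = finalVal H prm C (decodeProof p B K m prm.D C.N πb) τ := by
  unfold finalV finalVal
  congr 1
  refine sum_congr rfl fun φ _ => ?_
  congr 1
  congr 1
  funext j
  exact scV_queries τ πb ⟨φ, j⟩

/-- **The verdict on the true answer bits is acceptance of the decoded proof**:
`verdict τ ((queries τ).map πb) = true ↔ Accept H prm C (decodeProof πb) τ`.
[cite: BFLS1991, §5] [cite: AroraBarakCC2009, Def. 11.4, §8.3.2, §8.6] -/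
theorem verdict_iff_accept (τ : Tape (ZMod p) C prm.T) (πb : ℕ → Bool) :
    verdict p B H C prm e τ ((queries p B C prm e τ).map πb) = true ↔
      Accept H prm C (decodeProof p B K m prm.D C.N πb) τ := by
  rw [verdict_eq_true_iff]
  set π := decodeProof p B K m prm.D C.N πb with hπ
  have hrs : ∀ i : Fin prm.T, ∑ a ∈ range (prm.d + 2), diffCoeff prm.d a * rsVal p B prm ((queries p B C prm e τ).map πb) i a =
      testSum (diffCoeff prm.d) prm.d π.Y (τ.tests i).1 (τ.tests i).2 := fun i => by
    unfold testSum
    refine sum_congr rfl fun a ha => ?_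
    rw [rsVal_queries τ πb i (mem_range.1 ha)]
    rfl
  constructor
  · rintro ⟨h1, h2, h3⟩
    refine ⟨⟨fun i => ?_⟩, ⟨fun i hi => ⟨?_, ?_⟩, ?_⟩⟩
    · rw [← hrs]; exact h1 i
    · exact natDegree_decodeS_le p B K m prm.D πb _ _ _
    · have := h2 ⟨i, hi⟩
      rwa [msgRead_queries τ πb hi, chainV_queries τ πb hi.le] at this
    · have := h3
      rwa [finalV_queries, chainV_queries τ πb le_rfl] at this
  · rintro ⟨⟨h1⟩, ⟨h2, h3⟩⟩
    refine ⟨fun i => ?_, fun i => ?_, ?_⟩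
    · rw [hrs]; exact h1 i
    · rw [msgRead_queries τ πb i.isLt, chainV_queries τ πb i.isLt.le]; exact (h2 i i.isLt).2
    · rw [finalV_queries, chainV_queries τ πb le_rfl]; exact h3

end Verdict

/-! ### Encoding an abstract proof as a string -/

section Encoding

variable (p : ℕ) (B K m D : ℕ)

/-- **The word of a field element**: the `B`-bit word of its canonical representative. [cite: AroraBarakCC2009, §0.1] -/
def feWord (a : ZMod p) : List Bool := word B a.val

/-- Words have length `B`. [folklore] -/
@[simp] theorem length_feWord (a : ZMod p) : (feWord p B a).length = B := length_word _ _

/-- The challenge prefix with a given length and index. [folklore] -/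
def prefOfIdx (len v : ℕ) : List (ZMod p) := List.ofFn fun j : Fin len => ((v / p ^ (j : ℕ) % p : ℕ) : ZMod p)

/-- A bound on the keys of messages with prefixes shorter than `K`. [folklore] -/
def keyBound : ℕ := p ^ K * p * K * p ^ K

/-- **A block inside a string is a `drop`/`take`.** [folklore] -/
theorem blockAt_getD_eq_drop_take (l : List Bool) {pos B : ℕ} (h : pos + B ≤ l.length) :
    blockAt (fun t => l.getD t false) pos B = (l.drop pos).take B := by
  apply List.ext_getElem (by simp; omega)
  intro i h1 h2
  simp only [blockAt, List.getElem_map, List.getElem_range, List.getElem_take, List.getElem_drop]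
  simp only [length_blockAt] at h1
  exact List.getD_eq_getElem _ _ (by omega)

/-- **The block at `i · B` of a concatenation of `B`-bit words** is word `i`. [folklore] -/
theorem blockAt_flatMap_range (g : ℕ → List Bool) (hg : ∀ a, (g a).length = B) (n : ℕ) (rest : List Bool) {i : ℕ}
    (hi : i < n) : blockAt (fun t => ((List.range n).flatMap g ++ rest).getD t false) (i * B) B = g i := by
  have hlen : ((List.range n).flatMap g).length = n * B := by rw [length_flatMap_const g hg, List.length_range]
  have hiB : i * B + B ≤ n * B := by rw [← Nat.succ_mul]; exact Nat.mul_le_mul_right _ hi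
  rw [blockAt_getD_eq_drop_take _ (by rw [List.length_append, hlen]; omega), List.drop_append,
    List.take_append_of_le_length (by rw [List.length_drop, hlen]; omega),
    drop_take_flatMap_const g hg 0 _ (by simpa using hi), getD_range hi]

/-- Shifting the oracle past a prefix. [folklore] -/
theorem blockAt_getD_append_add (pre post : List Bool) (pos B : ℕ) :
    blockAt (fun t => (pre ++ post).getD t false) (pre.length + pos) B = blockAt (fun t => post.getD t false) pos B := by
  unfold blockAt
  refine List.map_congr_left fun i _ => ?_
  dsimp only
  rw [Nat.add_assoc]
  exact getD_append_right' _ _ _ _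

variable [Fact p.Prime]

/-- **The message stored under a key** (inverse of `msgKey` on admissible keys). [folklore] -/
def msgOfKey {N : ℕ} (π : Proof (ZMod p) K m N) (k : ℕ) : (ZMod p)[X] :=
  π.S (idxPt p K (k / p ^ K / K / p)) ((k / p ^ K / K % p : ℕ) : ZMod p) (prefOfIdx p (k / p ^ K % K) (k % p ^ K))

/-- **The proof string of an abstract proof**: the `pᵐ` words of `Y` in index order, then, key by
key, the `D + 1` coefficient words of the stored messages. [cite: BFLS1991, §5 (the proof as a table)] -/
def proofStr {N : ℕ} (π : Proof (ZMod p) K m N) : List Bool :=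
  (List.range (p ^ m)).flatMap (fun i => feWord p B (π.Y (idxPt p m i))) ++
  (List.range (keyBound p K * (D + 1))).flatMap fun t => feWord p B ((msgOfKey p K m π (t / (D + 1))).coeff (t % (D + 1)))

/-- Length of the `Y` part. [folklore] -/
theorem length_yPart {N : ℕ} (π : Proof (ZMod p) K m N) :
    ((List.range (p ^ m)).flatMap fun i => feWord p B (π.Y (idxPt p m i))).length = offY p B m := by
  rw [length_flatMap_const _ (fun _ => length_feWord p B _), List.length_range, offY, Nat.mul_comm]

/-- The key of a message with a short prefix is below the bound. [folklore] -/
theorem msgKey_lt (ρ : Fin K → ZMod p) (seed : ZMod p) {pref : List (ZMod p)} (hpref : pref.length < K) :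
    msgKey p K ρ seed pref < keyBound p K := by
  unfold msgKey keyBound
  have h1 : ptIdx p ρ * p + seed.val < p ^ K * p := by
    calc ptIdx p ρ * p + seed.val < ptIdx p ρ * p + p := Nat.add_lt_add_left (ZMod.val_lt seed) _
      _ = (ptIdx p ρ + 1) * p := by ring
      _ ≤ p ^ K * p := Nat.mul_le_mul_right _ (ptIdx_lt p ρ)
  have h2 : (ptIdx p ρ * p + seed.val) * K + pref.length < p ^ K * p * K := by
    calc (ptIdx p ρ * p + seed.val) * K + pref.length < (ptIdx p ρ * p + seed.val) * K + K := Nat.add_lt_add_left hpref _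
      _ = (ptIdx p ρ * p + seed.val + 1) * K := by ring
      _ ≤ p ^ K * p * K := Nat.mul_le_mul_right _ h1
  have h3 : prefIdx p K pref < p ^ K := DigitPoly.dval_lt p _ fun j => ZMod.val_lt _
  calc ((ptIdx p ρ * p + seed.val) * K + pref.length) * p ^ K + prefIdx p K pref
      < ((ptIdx p ρ * p + seed.val) * K + pref.length) * p ^ K + p ^ K := Nat.add_lt_add_left h3 _
    _ = ((ptIdx p ρ * p + seed.val) * K + pref.length + 1) * p ^ K := by ring
    _ ≤ p ^ K * p * K * p ^ K := Nat.mul_le_mul_right _ h2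

/-- Digits of a digit value. [folklore] -/
theorem digitsOf_dval {k : ℕ} {n : Fin k → ℕ} (hn : ∀ i, n i < p) : DigitPoly.digitsOf p (k := k) (DigitPoly.dval p n) = n := by
  have hp : 0 < p := (Fact.out : p.Prime).pos
  exact DigitPoly.dval_injective p (fun i => DigitPoly.digitsOf_lt hp _ i) hn
    (DigitPoly.dval_digitsOf hp (DigitPoly.dval_lt p n hn))

/-- The prefix is recovered from its length and index. [folklore] -/
theorem prefOfIdx_prefIdx {pref : List (ZMod p)} (hpref : pref.length ≤ K) :
    prefOfIdx p pref.length (prefIdx p K pref) = pref := by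
  unfold prefOfIdx prefIdx
  apply List.ext_getElem (by simp)
  intro j h1 h2
  rw [List.getElem_ofFn]
  have hdig := congrFun (digitsOf_dval p (k := K) (n := fun j : Fin K => (pref.getD j 0).val) fun j => ZMod.val_lt _) ⟨j, by omega⟩
  simp only [DigitPoly.digitsOf] at hdig
  dsimp only
  rw [hdig, List.getD_eq_getElem _ _ h2, ZMod.natCast_zmod_val]

/-- **The message stored under the key of `(ρ, seed, pref)` is `S ρ seed pref`** (short prefixes).
[folklore] -/
theorem msgOfKey_msgKey {N : ℕ} (π : Proof (ZMod p) K m N) (ρ : Fin K → ZMod p) (seed : ZMod p) {pref : List (ZMod p)}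
    (hpref : pref.length < K) : msgOfKey p K m π (msgKey p K ρ seed pref) = π.S ρ seed pref := by
  have h3 : prefIdx p K pref < p ^ K := DigitPoly.dval_lt p _ fun j => ZMod.val_lt _
  unfold msgOfKey msgKey
  obtain ⟨q1, r1⟩ := div_mod_block (k := (ptIdx p ρ * p + seed.val) * K + pref.length) h3
  rw [q1, r1]
  obtain ⟨q2, r2⟩ := div_mod_block (k := ptIdx p ρ * p + seed.val) hpref
  rw [q2, r2]
  obtain ⟨q3, r3⟩ := div_mod_block (k := ptIdx p ρ) (ZMod.val_lt seed)
  rw [q3, r3, idxPt_ptIdx, ZMod.natCast_zmod_val, prefOfIdx_prefIdx p K hpref.le]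

variable [hB : Fact (p ≤ 2 ^ B)]

/-- A field element is read back from its word. [folklore] -/
theorem natCast_bitsToNat_feWord (a : ZMod p) : ((bitsToNat (feWord p B a) : ℕ) : ZMod p) = a := by
  unfold feWord
  rw [bitsToNat_word_of_lt (lt_of_lt_of_le (ZMod.val_lt a) hB.out), ZMod.natCast_zmod_val]

/-- **Reading `Y` back**: the decoded oracle of the proof string is `Y`. [cite: BFLS1991, §5] -/
theorem readF_proofStr_posY {N : ℕ} (π : Proof (ZMod p) K m N) (z : Fin m → ZMod p) :
    readF p (fun t => (proofStr p B K m D π).getD t false) (posY p B m z) B = π.Y z := by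
  unfold readF readN posY proofStr
  rw [show B * ptIdx p z = ptIdx p z * B from Nat.mul_comm _ _,
    blockAt_flatMap_range B _ (fun _ => length_feWord p B _) _ _ (ptIdx_lt p z), idxPt_ptIdx,
    natCast_bitsToNat_feWord]

/-- **Reading a message coefficient back** (short prefix, `j ≤ D`). [cite: BFLS1991, §5] -/
theorem readF_proofStr_posS {N : ℕ} (π : Proof (ZMod p) K m N) (ρ : Fin K → ZMod p) (seed : ZMod p)
    {pref : List (ZMod p)} (hpref : pref.length < K) {j : ℕ} (hj : j < D + 1) :
    readF p (fun t => (proofStr p B K m D π).getD t false) (posS p B K m D ρ seed pref j) B = (π.S ρ seed pref).coeff j := by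
  unfold readF readN posS proofStr
  rw [← length_yPart p B K m (N := N) π, blockAt_getD_append_add,
    show B * ((D + 1) * msgKey p K ρ seed pref + j) = (msgKey p K ρ seed pref * (D + 1) + j) * B by ring]
  have hlt : msgKey p K ρ seed pref * (D + 1) + j < keyBound p K * (D + 1) := by
    calc msgKey p K ρ seed pref * (D + 1) + j < msgKey p K ρ seed pref * (D + 1) + (D + 1) := by omega
      _ = (msgKey p K ρ seed pref + 1) * (D + 1) := by ring
      _ ≤ keyBound p K * (D + 1) := Nat.mul_le_mul_right _ (msgKey_lt p K ρ seed hpref)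
  rw [← List.append_nil ((List.range (keyBound p K * (D + 1))).flatMap _),
    blockAt_flatMap_range B _ (fun _ => length_feWord p B _) _ [] hlt]
  obtain ⟨q1, r1⟩ := div_mod_block (k := msgKey p K ρ seed pref) hj
  rw [q1, r1, msgOfKey_msgKey p K m π ρ seed hpref, natCast_bitsToNat_feWord]

/-- **Decoding the proof string: the oracle.** [cite: BFLS1991, §5] -/
theorem decodeProof_proofStr_Y {N : ℕ} (π : Proof (ZMod p) K m N) :
    (decodeProof p B K m D N fun t => (proofStr p B K m D π).getD t false).Y = π.Y :=
  funext fun z => readF_proofStr_posY p B K m D π z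

/-- **Decoding the proof string: the messages** of degree `≤ D` along short prefixes are recovered.
[cite: AroraBarakCC2009, §8.3.2] -/
theorem decodeProof_proofStr_S {N : ℕ} (π : Proof (ZMod p) K m N) (ρ : Fin K → ZMod p) (seed : ZMod p)
    {pref : List (ZMod p)} (hpref : pref.length < K) (hdeg : (π.S ρ seed pref).natDegree ≤ D) :
    (decodeProof p B K m D N fun t => (proofStr p B K m D π).getD t false).S ρ seed pref = π.S ρ seed pref := by
  show decodeS p B K m D _ ρ seed pref = _
  unfold decodeS
  conv_rhs => rw [(π.S ρ seed pref).as_sum_range' (D + 1) (by omega)]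
  refine sum_congr rfl fun j hj => ?_
  rw [readF_proofStr_posS p B K m D π ρ seed hpref (mem_range.1 hj), C_mul_X_pow_eq_monomial]

end Encoding

/-! ### Acceptance depends only on the oracle and the short messages -/

section Transfer

variable {p : ℕ} [Fact p.Prime] {K m : ℕ} {H : Finset (ZMod p)} {C : CSP (ZMod p) K m} {prm : Params}

/-- **Acceptance of a proof transfers to any proof with the same oracle and the same messages of
degree `≤ D` along prefixes shorter than `K`.** [cite: BFLS1991, §5] -/
theorem accept_of_agree {π π' : Proof (ZMod p) K m C.N} (hY : π'.Y = π.Y)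
    (hS : ∀ (ρ : Fin K → ZMod p) (seed : ZMod p) (pref : List (ZMod p)), pref.length < K →
      (π.S ρ seed pref).natDegree ≤ prm.D → π'.S ρ seed pref = π.S ρ seed pref)
    {τ : Tape (ZMod p) C prm.T} (h : Accept H prm C π τ) : Accept H prm C π' τ := by
  have hmsgs : ∀ i, i < K → msgs prm C π' τ i = msgs prm C π τ i := fun i hi => by
    unfold msgs
    exact hS _ _ _ (by rw [List.length_take, List.length_ofFn]; omega) (h.sum.round i hi).1
  have hchain : ∀ i, i ≤ K → chain 0 (msgs prm C π' τ) (List.ofFn τ.r) i = chain 0 (msgs prm C π τ) (List.ofFn τ.r) i := by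
    intro i hi
    cases i with
    | zero => rfl
    | succ i => show (msgs prm C π' τ i).eval _ = (msgs prm C π τ i).eval _; rw [hmsgs i (by omega)]
  have hfinal : finalVal H prm C π' τ = finalVal H prm C π τ := by
    unfold finalVal scVal; rw [hY]
  refine ⟨⟨fun i => ?_⟩, ⟨fun i hi => ?_, ?_⟩⟩
  · rw [hY]; exact h.rs.test i
  · rw [hmsgs i hi, hchain i hi.le]; exact h.sum.round i hi
  · rw [hfinal, hchain K le_rfl]; exact h.sum.final

variable (B : ℕ) [Fact (p ≤ 2 ^ B)]

/-- **An accepted abstract proof stays accepted through its proof string**: if `π` is accepted on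
the tape `τ` then so is the decoding of `proofStr π`. [cite: BFLS1991, §5] [cite: AroraBarakCC2009, Def. 11.4] -/
theorem accept_decodeProof_proofStr (π : Proof (ZMod p) K m C.N) {τ : Tape (ZMod p) C prm.T} (h : Accept H prm C π τ) :
    Accept H prm C (decodeProof p B K m prm.D C.N fun t => (proofStr p B K m prm.D π).getD t false) τ :=
  accept_of_agree (decodeProof_proofStr_Y p B K m prm.D π)
    (fun ρ seed _ hpref hdeg => decodeProof_proofStr_S p B K m prm.D π ρ seed hpref hdeg) h

end Transfer

end PCPBits

end Literature.Computability.Complexity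

end
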